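import Mathlib
import Summits.Ventures.HodgeRepro.Tier4.Line4.SuppMeasureTranslate

/-!
# Tier4/Line4/SuppMeasureCover — C-L4-DIAG-COVER: the covering bound for the `DZ_f`-cut product measure of
diagonal-centre-invariant sets (a `DZ_f`-cut comparison tool for the folded ratio (F); no disintegration along `Z_q`)

Blind re-derivation cell `pub-hodge-repro`, Tier 4 «prove the step» (README §9–§10), seat t4-L1-p4 (gen 5; LINE L4,
self-named on the empty plate, STATUS S15601).  Tree path `lean/Summits/Ventures/HodgeRepro/Tier4/Line4/SuppMeasureCover.lean`.
Imports `Line4/SuppMeasureTranslate` (t4-L2-p3, p709303: `countable_centreFin`, `isFundamentalDomain_mul_left`, the (iv′)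
passage `exists_mem_levelDoubleCoset_suppMeasure_eq`) and through it `Line4/SuppMeasure` (`suppSet`, `suppMeasure`,
`measurableSet_suppSet`) and `Line4/RatioReduce` (`suppMeasure_eq_lintegral_fibre`'s instance recipe).  Mathlib-level; no
literature; no `def`.

THE RECORD (S15601).  Write `Φ(S) := (ν_f ⊗ ν′_f)(S ∩ (DZ_f × T′_f))` for a measurable `S ⊆ T_f × T′_f` that is invariant
under the DIAGONAL rational centre — `z ∈ Z(k)` (its image `centreFin W` in `T_f`) acting by `(c, c′) ↦ (z c, ζ c′)` with
`ζ ∈ T′_f` the same element of `G(𝔸)`.  Then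
(a) `Φ((b, b′) • S) = Φ(S)` for every `b ∈ T_f`, `b′ ∈ T′_f` (`measure_inter_domain_image_mul_eq`): Fubini slices `Φ`
    along `T_f` (`Measure.prod_apply`), the fibre function `c ↦ ν′_f(S_c)` is `Z(k)`-invariant by the Haar invariance of
    `ν′_f`, the change of variables `c ↦ b⁻¹ c` moves `DZ_f` to the fundamental domain `b⁻¹ DZ_f`
    (`isFundamentalDomain_mul_left`), and two fundamental domains integrate an invariant function equally
    (`IsFundamentalDomain.setLIntegral_eq`) — L2-p3's (iv) proof with a general invariant `S` in place of `suppSet γ`;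
(b) `U ⊆ ⋃_{i : ι} (b i, b′ i) • S ⇒ Φ(U) ≤ card ι · Φ(S)` (`measure_inter_domain_le_card_mul_of_subset_iUnion`).
USE AND LIMIT (S15635 and its correction): `suppSet γ₀ N γ₀` is measurable (`measurableSet_suppSet`) and
diagonal-centre-invariant (a central `z` cancels in `c⁻¹ γ₀,f c′`, `suppSet_diag_mul_mem_iff`), so ANY cover of a support
set by `M` diagonal translates of `suppSet γ₀ N γ₀` gives `suppMeasure N x ≤ M · suppMeasure N γ₀`
(`suppMeasure_le_mul_suppMeasure_of_subset_iUnion_fin`; at every `γ` through (iv′),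
`suppMeasure_le_mul_suppMeasure_of_cover_doubleCoset`); no measurable section `T_q ≅ Z_q × T_q/Z_q` and no value of a unit
`m(Δ(Z_q)(L × L′))` enter — Mathlib's `IsFundamentalDomain` API needs only the COUNTABLE `Z(k)` (`countable_centreFin`).
WHAT THIS DOES NOT DO: it does NOT reduce the folded display (F) of S15514 to such a cover UNIFORMLY in `x` — by
F-L4-PROJ-NONUNIFORM (t4-L2-p3 S15509) the double coset `K(N) γ₀,f K(N)` contains, at a place `v ∤ q` with `γ₀, g ∈ K_v`,
the local transporter `x_v = g⁻¹`, whose support set contains the graph `{(c, g c g⁻¹)}` over all of `T_v` — unbounded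
modulo `Δ(Z_f)` when `T_v / Z_v` is non-compact — so `suppMeasure N x = ⊤` there and no finite cover exists; the UNFOLDED
measure at `γ` (`DZ_f × T′_f` cut) is not uniformly comparable to the one at `γ₀`, and (F) must be proved through the
COMPACT cut `(ν_f ⊗ ν′_f)(suppSet γ ∩ (π_f D_T × π_f D_{T′}))` instead.  The covering bound of this module serves the
`γ₀` side of (F) (the unit: `suppSet γ₀ N γ₀ ⊇ Δ(Z_f)·(levelTf N × levelTf′ N)`, (v) of p709303, and its finitely many
translates) and every DZ_f-cut comparison in which a cover is actually available.

Nothing here says anything about the status of the Hodge conjecture for CM abelian varieties, which is NOT proved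
(HC_CM is NOT proved by anyone in this repository).
-/

set_option autoImplicit false
noncomputable section
namespace Summit.Ventures.HodgeRepro.Tier4.Line4
open Summit.Ventures.HodgeRepro.Tier4 Summit.Ventures.HodgeRepro.Tier4.Common
  Summit.Ventures.HodgeRepro.Tier4.Line1 MeasureTheory
open scoped ENNReal NNReal Pointwise

section Algebra
variable {k : Type} [Field k] [NumberField k] (W : PlaneData k)

/-- **A central element of `G(𝔸)` sitting in `T_f` and in `T′_f` cancels in the support condition**: for `z ∈ T_f`,
`ζ ∈ T′_f` the SAME central element of `G(𝔸)`, `(z c, ζ c′) ∈ suppSet γ₀ N γ ↔ (c, c′) ∈ suppSet γ₀ N γ`. -/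
theorem suppSet_diag_mul_mem_iff (γ₀ : GA W) (N : ℕ) (γ : GA W) {z : torusFin W} {ζ : torusFin' W}
    (hzζ : ((ζ : torusT' W) : GA W) = ((z : torusT W) : GA W))
    (hz : ((z : torusT W) : GA W) ∈ Subgroup.center (GA W)) (p : torusFin W × torusFin' W) :
    (z * p.1, ζ * p.2) ∈ suppSet W γ₀ N γ ↔ p ∈ suppSet W γ₀ N γ := by
  simp only [suppSet, Set.mem_setOf_eq, Subgroup.coe_mul, mul_inv_rev, hzζ]
  have hC : ∀ g : GA W, Commute g ((z : torusT W) : GA W) := fun g => Subgroup.mem_center_iff.1 hz g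
  have h : (((p.1 : torusT W) : GA W))⁻¹ * (((z : torusT W) : GA W))⁻¹ * GA.ofFinPart W γ *
      (((z : torusT W) : GA W) * ((p.2 : torusT' W) : GA W)) =
      (((p.1 : torusT W) : GA W))⁻¹ * GA.ofFinPart W γ * ((p.2 : torusT' W) : GA W) := by
    calc (((p.1 : torusT W) : GA W))⁻¹ * (((z : torusT W) : GA W))⁻¹ * GA.ofFinPart W γ *
          (((z : torusT W) : GA W) * ((p.2 : torusT' W) : GA W))
        = (((p.1 : torusT W) : GA W))⁻¹ * ((((z : torusT W) : GA W))⁻¹ * (GA.ofFinPart W γ *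
            ((z : torusT W) : GA W))) * ((p.2 : torusT' W) : GA W) := by
          simp only [mul_assoc]
      _ = (((p.1 : torusT W) : GA W))⁻¹ * ((((z : torusT W) : GA W))⁻¹ * (((z : torusT W) : GA W) *
            GA.ofFinPart W γ)) * ((p.2 : torusT' W) : GA W) := by
          rw [(hC (GA.ofFinPart W γ)).eq]
      _ = _ := by rw [inv_mul_cancel_left]
  rw [h]

/-- **The rational centre acts diagonally**: for `z ∈ centreFin W` there is `ζ ∈ T′_f`, the same element of `G(𝔸)`,
and that element is central in `G(𝔸)` (`fibreSet_centreFin_mul`'s construction, made explicit). -/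
theorem exists_diag_of_mem_centreFin {z : torusFin W} (hz : z ∈ centreFin W) :
    ∃ ζ : torusFin' W, ((ζ : torusT' W) : GA W) = ((z : torusT W) : GA W) ∧
      ((z : torusT W) : GA W) ∈ Subgroup.center (GA W) := by
  obtain ⟨z₀, hz₀, rfl⟩ := hz
  have hzc : ((finTfHom W z₀ : torusT W) : GA W) ∈ centre W := by
    rw [coe_coe_finTfHom]
    exact ofFinPart_mem_centre W (rationalCentreT.mem_centre W hz₀)
  have hzf : ((finTfHom W z₀ : torusT W) : GA W) ∈ finitePart W := coe_coe_mem_finitePart W _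
  exact ⟨⟨⟨((finTfHom W z₀ : torusT W) : GA W), centre_le_torusT' W hzc⟩, Subgroup.mem_subgroupOf.2 hzf⟩, rfl,
    centre_le_center W hzc⟩

/-- **The support set is diagonal-rational-centre-invariant** (the invariance shape the covering bound consumes). -/
theorem suppSet_centreFin_invariant (γ₀ : GA W) (N : ℕ) (γ : GA W) :
    ∀ z ∈ centreFin W, ∃ ζ : torusFin' W, ∀ p : torusFin W × torusFin' W,
      (z * p.1, ζ * p.2) ∈ suppSet W γ₀ N γ ↔ p ∈ suppSet W γ₀ N γ := by
  intro z hz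
  obtain ⟨ζ, hzζ, hc⟩ := exists_diag_of_mem_centreFin W hz
  exact ⟨ζ, fun p => suppSet_diag_mul_mem_iff W γ₀ N γ hzζ hc p⟩

/-- The diagonal translate of a set by `(b, b′)` is the preimage under the translate by `(b⁻¹, b′⁻¹)`. -/
theorem image_diag_mul_eq_preimage (b : torusFin W) (b' : torusFin' W) (S : Set (torusFin W × torusFin' W)) :
    (fun p : torusFin W × torusFin' W => (b * p.1, b' * p.2)) '' S =
      (fun p : torusFin W × torusFin' W => (b⁻¹ * p.1, b'⁻¹ * p.2)) ⁻¹' S := by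
  ext p
  constructor
  · rintro ⟨q, hq, rfl⟩
    simpa [Set.mem_preimage] using hq
  · intro hp
    exact ⟨(b⁻¹ * p.1, b'⁻¹ * p.2), hp, by simp⟩

end Algebra

section Measure
variable {k : Type} [Field k] [NumberField k] (W : PlaneData k) [MeasurableSpace (GA W)] [BorelSpace (GA W)]
  (νf : Measure (torusFin W)) (νf' : Measure (torusFin' W)) (DZf : Set (torusFin W))

omit [BorelSpace (GA W)] in
/-- **Fubini for the `DZ_f`-cut product measure**: `(ν_f ⊗ ν′_f)(S ∩ (DZ_f × T′_f)) = ∫⁻_{c ∈ DZ_f} ν′_f(S_c) dν_f`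
(`S_c = Prod.mk c ⁻¹' S` the slice). -/
theorem measure_inter_domain_eq_lintegral [νf'.IsHaarMeasure] (hDZf : MeasurableSet DZf)
    {S : Set (torusFin W × torusFin' W)} (hS : MeasurableSet S) :
    (νf.prod νf') (S ∩ DZf ×ˢ Set.univ) = ∫⁻ c in DZf, νf' (Prod.mk c ⁻¹' S) ∂νf := by
  haveI : LocallyCompactSpace (torusFin' W) := locallyCompact_torusFin' W
  haveI : SecondCountableTopology (torusFin' W) := secondCountable_torusFin' W
  haveI : IsLocallyFiniteMeasure νf' := isLocallyFiniteMeasure_of_isFiniteMeasureOnCompacts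
  haveI : SigmaFinite νf' := sigmaFinite_of_locallyFinite
  have hmeas : MeasurableSet (S ∩ DZf ×ˢ Set.univ) := hS.inter (hDZf.prod MeasurableSet.univ)
  rw [Measure.prod_apply hmeas, ← lintegral_indicator hDZf]
  refine lintegral_congr fun c => ?_
  by_cases hc : c ∈ DZf
  · rw [Set.indicator_of_mem hc]
    congr 1
    ext c'
    simp [hc]
  · rw [Set.indicator_of_notMem hc]
    have : Prod.mk c ⁻¹' (S ∩ DZf ×ˢ Set.univ) = ∅ := by
      ext c'
      simp [hc]
    rw [this, measure_empty]

/-- **The fibre function of a diagonal-invariant set is `Z(k)`-invariant**: `ν′_f(S_{z c}) = ν′_f(S_c)` for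
`z ∈ centreFin W`. -/
theorem measure_preimage_mk_centreFin_smul [νf'.IsHaarMeasure] {S : Set (torusFin W × torusFin' W)}
    (hinv : ∀ z ∈ centreFin W, ∃ ζ : torusFin' W, ∀ p : torusFin W × torusFin' W, (z * p.1, ζ * p.2) ∈ S ↔ p ∈ S)
    (z : centreFin W) (c : torusFin W) :
    νf' (Prod.mk (z • c) ⁻¹' S) = νf' (Prod.mk c ⁻¹' S) := by
  haveI : BorelSpace (torusT' W) := Subtype.borelSpace _
  haveI : BorelSpace (torusFin' W) := Subtype.borelSpace _
  obtain ⟨ζ, hζ⟩ := hinv z z.2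
  have h : Prod.mk (z • c) ⁻¹' S = (fun c' : torusFin' W => ζ⁻¹ * c') ⁻¹' (Prod.mk c ⁻¹' S) := by
    ext c'
    simp only [Set.mem_preimage]
    change ((z : torusFin W) * c, c') ∈ S ↔ (c, ζ⁻¹ * c') ∈ S
    rw [← hζ (c, ζ⁻¹ * c')]
    simp
  rw [h]
  exact measure_preimage_mul νf' ζ⁻¹ _

/-- **(a) translation invariance of the `DZ_f`-cut product measure on diagonal-invariant sets**:
`Φ((b, b′) • S) = Φ(S)` for every `b ∈ T_f`, `b′ ∈ T′_f`. -/
theorem measure_inter_domain_image_mul_eq [νf.IsHaarMeasure] [νf'.IsHaarMeasure] (hDZf : MeasurableSet DZf)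
    (hfd : IsFundamentalDomain (centreFin W) DZf νf) {S : Set (torusFin W × torusFin' W)} (hS : MeasurableSet S)
    (hinv : ∀ z ∈ centreFin W, ∃ ζ : torusFin' W, ∀ p : torusFin W × torusFin' W, (z * p.1, ζ * p.2) ∈ S ↔ p ∈ S)
    (b : torusFin W) (b' : torusFin' W) :
    (νf.prod νf') ((fun p : torusFin W × torusFin' W => (b * p.1, b' * p.2)) '' S ∩ DZf ×ˢ Set.univ) =
      (νf.prod νf') (S ∩ DZf ×ˢ Set.univ) := by
  haveI : BorelSpace (torusT W) := Subtype.borelSpace _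
  haveI : BorelSpace (torusFin W) := Subtype.borelSpace _
  haveI : BorelSpace (torusT' W) := Subtype.borelSpace _
  haveI : BorelSpace (torusFin' W) := Subtype.borelSpace _
  haveI : Countable (centreFin W) := countable_centreFin W
  haveI : SMulInvariantMeasure (torusFin W) (torusFin W) νf := ⟨fun c _ _ => measure_preimage_mul νf c _⟩
  haveI : SMulInvariantMeasure (centreFin W) (torusFin W) νf := Subgroup.smulInvariantMeasure _
  haveI : MeasurableConstSMul (torusFin W) (torusFin W) := ⟨fun c => measurable_const_mul c⟩
  haveI : MeasurableConstSMul (centreFin W) (torusFin W) := ⟨fun c => measurable_const_mul (c : torusFin W)⟩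
  -- the translate is a preimage under a measurable map
  have hmap : Measurable (fun p : torusFin W × torusFin' W => (b⁻¹ * p.1, b'⁻¹ * p.2)) :=
    ((measurable_const_mul b⁻¹).comp measurable_fst).prodMk ((measurable_const_mul b'⁻¹).comp measurable_snd)
  rw [image_diag_mul_eq_preimage, measure_inter_domain_eq_lintegral W νf νf' DZf hDZf (hmap hS),
    measure_inter_domain_eq_lintegral W νf νf' DZf hDZf hS]
  -- the slice of the translate is a `T′_f`-translate of the slice at `b⁻¹ c`
  have hslice : ∀ c : torusFin W,
      νf' (Prod.mk c ⁻¹' ((fun p : torusFin W × torusFin' W => (b⁻¹ * p.1, b'⁻¹ * p.2)) ⁻¹' S)) =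
        νf' (Prod.mk (b⁻¹ * c) ⁻¹' S) := by
    intro c
    have h : Prod.mk c ⁻¹' ((fun p : torusFin W × torusFin' W => (b⁻¹ * p.1, b'⁻¹ * p.2)) ⁻¹' S) =
        (fun c' : torusFin' W => b'⁻¹ * c') ⁻¹' (Prod.mk (b⁻¹ * c) ⁻¹' S) := by
      ext c'
      simp [Set.mem_preimage]
    rw [h]
    exact measure_preimage_mul νf' b'⁻¹ _
  simp_rw [hslice]
  -- change of variables `c ↦ b⁻¹ c`, then the two fundamental domains
  have hemb : MeasurableEmbedding (fun c : torusFin W => b⁻¹ * c) :=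
    (MeasurableEquiv.mulLeft b⁻¹).measurableEmbedding
  have hpre : (fun c : torusFin W => b⁻¹ * c) ⁻¹' ((fun c : torusFin W => b⁻¹ * c) '' DZf) = DZf :=
    Set.preimage_image_eq _ (mul_right_injective b⁻¹)
  have hcv := (measurePreserving_mul_left νf b⁻¹).setLIntegral_comp_preimage_emb hemb
    (fun c => νf' (Prod.mk c ⁻¹' S)) ((fun c : torusFin W => b⁻¹ * c) '' DZf)
  rw [hpre] at hcv
  rw [hcv]
  exact (isFundamentalDomain_mul_left W νf DZf hfd b⁻¹).setLIntegral_eq hfd (fun c => νf' (Prod.mk c ⁻¹' S))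
    (measure_preimage_mk_centreFin_smul W νf' hinv)

/-- **(b) THE COVERING BOUND**: if `U` is covered by `card ι` diagonal translates of a measurable diagonal-invariant
`S`, then `Φ(U) ≤ card ι · Φ(S)`. -/
theorem measure_inter_domain_le_card_mul_of_subset_iUnion [νf.IsHaarMeasure] [νf'.IsHaarMeasure]
    (hDZf : MeasurableSet DZf) (hfd : IsFundamentalDomain (centreFin W) DZf νf)
    {S : Set (torusFin W × torusFin' W)} (hS : MeasurableSet S)
    (hinv : ∀ z ∈ centreFin W, ∃ ζ : torusFin' W, ∀ p : torusFin W × torusFin' W, (z * p.1, ζ * p.2) ∈ S ↔ p ∈ S)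
    {ι : Type} [Fintype ι] (b : ι → torusFin W) (b' : ι → torusFin' W) {U : Set (torusFin W × torusFin' W)}
    (hU : U ⊆ ⋃ i, (fun p : torusFin W × torusFin' W => (b i * p.1, b' i * p.2)) '' S) :
    (νf.prod νf') (U ∩ DZf ×ˢ Set.univ) ≤ Fintype.card ι * (νf.prod νf') (S ∩ DZf ×ˢ Set.univ) := by
  calc (νf.prod νf') (U ∩ DZf ×ˢ Set.univ)
      ≤ (νf.prod νf') (⋃ i, (fun p : torusFin W × torusFin' W => (b i * p.1, b' i * p.2)) '' S ∩ DZf ×ˢ Set.univ) := by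
        apply measure_mono
        rw [← Set.iUnion_inter]
        exact Set.inter_subset_inter_left _ hU
    _ ≤ ∑ i, (νf.prod νf') ((fun p : torusFin W × torusFin' W => (b i * p.1, b' i * p.2)) '' S ∩ DZf ×ˢ Set.univ) :=
        measure_iUnion_fintype_le _ _
    _ = ∑ _i : ι, (νf.prod νf') (S ∩ DZf ×ˢ Set.univ) := by
        refine Finset.sum_congr rfl fun i _ => ?_
        exact measure_inter_domain_image_mul_eq W νf νf' DZf hDZf hfd hS hinv (b i) (b' i)
    _ = Fintype.card ι * (νf.prod νf') (S ∩ DZf ×ˢ Set.univ) := by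
        rw [Finset.sum_const, Finset.card_univ, nsmul_eq_mul]

end Measure

section Ratio
variable {k : Type} [Field k] [NumberField k] (W : PlaneData k) [MeasurableSpace (GA W)] [BorelSpace (GA W)]
  (νf : Measure (torusFin W)) (νf' : Measure (torusFin' W)) (γ₀ : GA W) (DZf : Set (torusFin W))

/-- **The (F) form, general invariant set**: if `suppSet γ₀ N x` is covered by `card ι` diagonal translates of a
measurable diagonal-invariant `S ⊆ suppSet γ₀ N γ₀`, then `suppMeasure N x ≤ card ι · suppMeasure N γ₀`. -/
theorem suppMeasure_le_card_mul_suppMeasure_of_subset_iUnion' [νf.IsHaarMeasure] [νf'.IsHaarMeasure] {N : ℕ}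
    (hDZf : MeasurableSet DZf) (hfd : IsFundamentalDomain (centreFin W) DZf νf) (x : GA W)
    {S : Set (torusFin W × torusFin' W)} (hS : MeasurableSet S)
    (hinv : ∀ z ∈ centreFin W, ∃ ζ : torusFin' W, ∀ p : torusFin W × torusFin' W, (z * p.1, ζ * p.2) ∈ S ↔ p ∈ S)
    (hS₀ : S ⊆ suppSet W γ₀ N γ₀) {ι : Type} [Fintype ι] (b : ι → torusFin W) (b' : ι → torusFin' W)
    (hcov : suppSet W γ₀ N x ⊆ ⋃ i, (fun p : torusFin W × torusFin' W => (b i * p.1, b' i * p.2)) '' S) :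
    suppMeasure W νf νf' γ₀ DZf N x ≤ Fintype.card ι * suppMeasure W νf νf' γ₀ DZf N γ₀ := by
  unfold suppMeasure
  calc (νf.prod νf') (suppSet W γ₀ N x ∩ DZf ×ˢ Set.univ)
      ≤ Fintype.card ι * (νf.prod νf') (S ∩ DZf ×ˢ Set.univ) :=
        measure_inter_domain_le_card_mul_of_subset_iUnion W νf νf' DZf hDZf hfd hS hinv b b' hcov
    _ ≤ Fintype.card ι * (νf.prod νf') (suppSet W γ₀ N γ₀ ∩ DZf ×ˢ Set.univ) :=
        mul_le_mul_right (measure_mono (Set.inter_subset_inter_left _ hS₀)) _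

/-- **THE (F) FORM**: a cover of `suppSet γ₀ N x` by `card ι` diagonal translates of `suppSet γ₀ N γ₀` bounds the
unfolded support measure at `x` by `card ι` times the one at `γ₀` — no disintegration along the finite centre. -/
theorem suppMeasure_le_card_mul_suppMeasure_of_subset_iUnion [νf.IsHaarMeasure] [νf'.IsHaarMeasure] {N : ℕ}
    (hN : N ≠ 0) (hDZf : MeasurableSet DZf) (hfd : IsFundamentalDomain (centreFin W) DZf νf) (x : GA W)
    {ι : Type} [Fintype ι] (b : ι → torusFin W) (b' : ι → torusFin' W)
    (hcov : suppSet W γ₀ N x ⊆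
      ⋃ i, (fun p : torusFin W × torusFin' W => (b i * p.1, b' i * p.2)) '' suppSet W γ₀ N γ₀) :
    suppMeasure W νf νf' γ₀ DZf N x ≤ Fintype.card ι * suppMeasure W νf νf' γ₀ DZf N γ₀ :=
  suppMeasure_le_card_mul_suppMeasure_of_subset_iUnion' W νf νf' γ₀ DZf hDZf hfd x (measurableSet_suppSet W γ₀ hN γ₀)
    (suppSet_centreFin_invariant W γ₀ N γ₀) subset_rfl b b' hcov

/-- **THE (F) FORM WITH A FIXED CARDINALITY** (crit-2 g9 S15609): `M` translates, `M` fixed before `N` and `x`. -/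
theorem suppMeasure_le_mul_suppMeasure_of_subset_iUnion_fin [νf.IsHaarMeasure] [νf'.IsHaarMeasure] (M : ℕ) {N : ℕ}
    (hN : N ≠ 0) (hDZf : MeasurableSet DZf) (hfd : IsFundamentalDomain (centreFin W) DZf νf) (x : GA W)
    (b : Fin M → torusFin W) (b' : Fin M → torusFin' W)
    (hcov : suppSet W γ₀ N x ⊆
      ⋃ i, (fun p : torusFin W × torusFin' W => (b i * p.1, b' i * p.2)) '' suppSet W γ₀ N γ₀) :
    suppMeasure W νf νf' γ₀ DZf N x ≤ M * suppMeasure W νf νf' γ₀ DZf N γ₀ := by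
  have h := suppMeasure_le_card_mul_suppMeasure_of_subset_iUnion W νf νf' γ₀ DZf hN hDZf hfd x b b' hcov
  rwa [Fintype.card_fin] at h

/-- **From a cover at the points of the double coset to every rational point** (through (iv′),
`exists_mem_levelDoubleCoset_suppMeasure_eq`): if for every `x ∈ K(N) γ₀,f K(N)` in the finite part the support set at
`x` is covered by `M` diagonal translates of the one at `γ₀`, then `suppMeasure N γ ≤ M · suppMeasure N γ₀` for EVERY
`γ` (a support set missing `DZ_f × T′_f` has measure `0`). -/
theorem suppMeasure_le_mul_suppMeasure_of_cover_doubleCoset [νf.IsHaarMeasure] [νf'.IsHaarMeasure] (M : ℕ) {N : ℕ}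
    (hN : N ≠ 0) (hDZf : MeasurableSet DZf) (hfd : IsFundamentalDomain (centreFin W) DZf νf)
    (hcov : ∀ x ∈ levelDoubleCoset W N (GA.ofFinPart W γ₀), x ∈ finitePart W →
      ∃ (b : Fin M → torusFin W) (b' : Fin M → torusFin' W), suppSet W γ₀ N x ⊆
        ⋃ i, (fun p : torusFin W × torusFin' W => (b i * p.1, b' i * p.2)) '' suppSet W γ₀ N γ₀)
    (γ : GA W) :
    suppMeasure W νf νf' γ₀ DZf N γ ≤ M * suppMeasure W νf νf' γ₀ DZf N γ₀ := by
  by_cases hne : (suppSet W γ₀ N γ ∩ DZf ×ˢ Set.univ).Nonempty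
  · obtain ⟨x, hx, hxf, heq⟩ := exists_mem_levelDoubleCoset_suppMeasure_eq W νf νf' γ₀ DZf hN hDZf hfd γ hne
    obtain ⟨b, b', hb⟩ := hcov x hx hxf
    rw [heq]
    exact suppMeasure_le_mul_suppMeasure_of_subset_iUnion_fin W νf νf' γ₀ DZf M hN hDZf hfd x b b' hb
  · have h0 : suppMeasure W νf νf' γ₀ DZf N γ = 0 := by
      unfold suppMeasure
      rw [Set.not_nonempty_iff_eq_empty.1 hne, measure_empty]
    rw [h0]
    exact zero_le

end Ratio


end Summit.Ventures.HodgeRepro.Tier4.Line4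

end
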